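import Mathlib
import Summits.NavierStokesRegularity.NavierStokesRegularity.Theorems.PowerGaugeEulerLiouville.Negative.BudgetedClassicalAncientFlow

/-!
# Crux `EulerZoomLiouville.PowerGaugeEulerLiouville` (stmt-NavierStokesRegularity-19832) — negative edge, FORWARD form:
# a RELAXING GLOBAL CLASSICAL EULER FLOW refutes the crux for every `ρ ∈ (0, ½]`

Negative-lane record (prover hand leafhand-ns-eulerzoomliouville-8 g0; `--supports` stmt-19832), the time-reversed
reading of `…Negative.BudgetedClassicalAncientFlow` made kernel-checked.  TIME REVERSAL
`u(t,x) = −v(−t,x)`, `p(t,x) = q(−t,x)` maps classical Euler flows on `(0,∞) × ℝ³` to classical Euler flows on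
`(−∞,0) × ℝ³` (`isClassicalEulerSolutionOn_timeReversal`: `∂ₜu(t) = (∂ₛv)(−t)`, `(u·∇)u = (v·∇)v`, `∇p = ∇q`,
`div u = −div v = 0`), and carries the three global budgets and the local bounds across (`(t,x) ↦ (−t,x)` preserves
Lebesgue measure, `setLIntegral_timeReversal`; `|−A|²_F = |A|²_F`).  Hence

* `powerGaugeEulerLiouville_false_of_forwardRelaxingClassicalFlow`: a classical Euler flow `(v,q)` on `(0,∞) × ℝ³`,
  nonzero at one point, with `∫|v(s)|² ≤ M` for all `s > 0`, `∫₀^∞∫|∇v|²_F ≤ M` (square-summable enstrophy —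
  «relaxation to rest in `Ḣ¹` at bounded energy»), `∫₀^∞∫|q|^{3/2} ≤ M`, and `v, ∇v, q` bounded on the initial
  unit cylinder `(0,1) × B₁`, refutes the crux `PowerGaugeEulerLiouville` (at every `ρ ∈ (0,½]`; instantiated at `½`).

So the open window `0 < ρ ≤ ½` of Seregin's Euler-zoom Liouville statement is refuted by ANY global smooth finite-energy
Euler flow whose enstrophy is square-summable in time (with the mild pressure budget): a FORWARD-dynamics existence
question («does 3-D Euler admit complete depletion?») rather than a self-similar-profile question.  No such flow is
known; steady and travelling flows have constant enstrophy, and on a closed vortex tube of flux `Γ` and volume `V`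
Kelvin's theorem with incompressibility heuristically keeps the enstrophy `≳ Γ²/V^{1/3}`.

WHAT THIS IS NOT: not a refutation of the crux, of a stub, or of the route; not a claim about Navier–Stokes; the
relaxing flow is NOT constructed here and is not known to exist. [folklore] -/

noncomputable section
set_option linter.dupNamespace false
namespace Summit.NavierStokesRegularity.NavierStokesRegularity.Theorems.PowerGaugeEulerLiouville.Negative

open MeasureTheory Set Function Filter Topology Metric Literature.Analysis Literature.Analysis.FluidPDE
open scoped NNReal ENNReal Laplacian

/-! ## Time reversal of classical Euler flows -/

/-- `div (−v) = −div v` (pointwise classical divergence = trace of the Fréchet derivative). [folklore] -/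
theorem divergence_neg_field (v : EuclideanSpace ℝ (Fin 3) → EuclideanSpace ℝ (Fin 3)) (x : EuclideanSpace ℝ (Fin 3)) :
    VectorCalculus.divergence (fun y => -v y) x = -VectorCalculus.divergence v x := by
  simp only [VectorCalculus.divergence, fderiv_fun_neg, ContinuousLinearMap.toLinearMap_neg, map_neg]

/-- The negative of a divergence-free field is divergence free. [folklore] -/
theorem isDivFree_neg_field {v : EuclideanSpace ℝ (Fin 3) → EuclideanSpace ℝ (Fin 3)} (hv : VectorCalculus.IsDivFree v) :
    VectorCalculus.IsDivFree (fun y => -v y) := fun x => by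
  rw [divergence_neg_field, hv x, neg_zero]

/-- **Time reversal of a classical Euler flow.**  If `(v,q)` is a classical (jointly `C^∞`) Euler flow on
`(0,∞) × ℝ³`, then `u(t,x) = −v(−t,x)`, `p(t,x) = q(−t,x)` is a classical Euler flow on `(−∞,0) × ℝ³`. [folklore] -/
theorem isClassicalEulerSolutionOn_timeReversal
    {v : ℝ → EuclideanSpace ℝ (Fin 3) → EuclideanSpace ℝ (Fin 3)} {q : ℝ → EuclideanSpace ℝ (Fin 3) → ℝ}
    (hsol : IsClassicalEulerSolutionOn (Ioi (0 : ℝ)) 0 v q) :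
    IsClassicalEulerSolutionOn (Iio (0 : ℝ)) 0 (fun t x => -v (-t) x) (fun t x => q (-t) x) := by
  have hR : ContDiff ℝ (⊤ : ℕ∞)
      (fun z : ℝ × EuclideanSpace ℝ (Fin 3) => ((-z.1, z.2) : ℝ × EuclideanSpace ℝ (Fin 3))) :=
    (contDiff_fst.neg).prodMk contDiff_snd
  have hmaps : MapsTo (fun z : ℝ × EuclideanSpace ℝ (Fin 3) => ((-z.1, z.2) : ℝ × EuclideanSpace ℝ (Fin 3)))
      (Iio (0 : ℝ) ×ˢ (univ : Set (EuclideanSpace ℝ (Fin 3)))) (Ioi (0 : ℝ) ×ˢ (univ : Set (EuclideanSpace ℝ (Fin 3)))) :=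
    fun z hz => show ((-z.1, z.2) : ℝ × EuclideanSpace ℝ (Fin 3)) ∈ Ioi (0 : ℝ) ×ˢ (univ : Set (EuclideanSpace ℝ (Fin 3)))
      from ⟨neg_pos.mpr (show z.1 < 0 from hz.1), mem_univ _⟩
  have hv : ContDiffOn ℝ (⊤ : ℕ∞) (uncurry v) (Ioi (0 : ℝ) ×ˢ (univ : Set (EuclideanSpace ℝ (Fin 3)))) :=
    hsol.smooth_velocity
  have hq : ContDiffOn ℝ (⊤ : ℕ∞) (uncurry q) (Ioi (0 : ℝ) ×ˢ (univ : Set (EuclideanSpace ℝ (Fin 3)))) :=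
    hsol.smooth_pressure
  refine ⟨?_, ?_, ?_, ?_⟩
  · show ContDiffOn ℝ (⊤ : ℕ∞) (fun z : ℝ × EuclideanSpace ℝ (Fin 3) => -(uncurry v (-z.1, z.2)))
      (Iio (0 : ℝ) ×ˢ (univ : Set (EuclideanSpace ℝ (Fin 3))))
    exact (hv.comp hR.contDiffOn hmaps).neg
  · show ContDiffOn ℝ (⊤ : ℕ∞) (fun z : ℝ × EuclideanSpace ℝ (Fin 3) => uncurry q (-z.1, z.2))
      (Iio (0 : ℝ) ×ˢ (univ : Set (EuclideanSpace ℝ (Fin 3))))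
    exact hq.comp hR.contDiffOn hmaps
  · intro t ht x
    have ht' : -t ∈ Ioi (0 : ℝ) := mem_Ioi.mpr (neg_pos.mpr ht)
    have h1 : timeDerivWithin (Iio (0 : ℝ)) (fun t x => -v (-t) x) t x = timeDeriv (fun t x => -v (-t) x) t x :=
      timeDerivWithin_of_mem_interior (by rwa [interior_Iio]) x
    have h2 : timeDerivWithin (Ioi (0 : ℝ)) v (-t) x = timeDeriv v (-t) x :=
      timeDerivWithin_of_mem_interior (by rwa [interior_Ioi]) x
    have h3 : timeDeriv (fun t x => -v (-t) x) t x = timeDeriv v (-t) x := by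
      simp only [timeDeriv_apply]
      rw [deriv.fun_neg, deriv_comp_neg (fun s => v s x) t, neg_neg]
    have h4 : convect (fun y => -v (-t) y) (fun y => -v (-t) y) x = convect (v (-t)) (v (-t)) x := by
      rw [convect_apply, convect_apply, fderiv_fun_neg, neg_apply, map_neg, neg_neg]
    have hm := hsol.momentum (-t) ht' x
    rw [h2] at hm
    simp only [zero_smul, Pi.zero_apply, add_zero, zero_sub] at hm ⊢
    rw [h1, h3, h4, hm]
  · intro t ht
    exact isDivFree_neg_field (hsol.divFree (-t) (mem_Ioi.mpr (neg_pos.mpr ht)))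

/-- **Lebesgue measure on `ℝ × ℝ³` is invariant under the time reflection `(t,x) ↦ (−t,x)`**, in the form of a
substitution rule for lower integrals over the two half slabs (no measurability needed). [folklore] -/
theorem setLIntegral_timeReversal (F : ℝ × EuclideanSpace ℝ (Fin 3) → ℝ≥0∞) :
    ∫⁻ z in Iio (0 : ℝ) ×ˢ (univ : Set (EuclideanSpace ℝ (Fin 3))), F (-z.1, z.2) =
      ∫⁻ w in Ioi (0 : ℝ) ×ˢ (univ : Set (EuclideanSpace ℝ (Fin 3))), F w := by
  set e : ℝ × EuclideanSpace ℝ (Fin 3) ≃ᵐ ℝ × EuclideanSpace ℝ (Fin 3) :=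
    (MeasurableEquiv.neg ℝ).prodCongr (MeasurableEquiv.refl (EuclideanSpace ℝ (Fin 3))) with he
  have hecoe : ∀ z : ℝ × EuclideanSpace ℝ (Fin 3), e z = (-z.1, z.2) := fun z => rfl
  have hmp : MeasurePreserving e (volume : Measure (ℝ × EuclideanSpace ℝ (Fin 3))) volume := by
    rw [Measure.volume_eq_prod]
    exact (Measure.measurePreserving_neg (volume : Measure ℝ)).prod
      (MeasurePreserving.id (volume : Measure (EuclideanSpace ℝ (Fin 3))))
  have hpre : e ⁻¹' (Ioi (0 : ℝ) ×ˢ (univ : Set (EuclideanSpace ℝ (Fin 3)))) =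
      Iio (0 : ℝ) ×ˢ (univ : Set (EuclideanSpace ℝ (Fin 3))) := by
    ext z
    simp only [mem_preimage, hecoe, mem_prod, mem_Ioi, mem_Iio, mem_univ, and_true, neg_pos]
  have h := hmp.setLIntegral_comp_preimage_emb e.measurableEmbedding F
    (Ioi (0 : ℝ) ×ˢ (univ : Set (EuclideanSpace ℝ (Fin 3))))
  rw [hpre] at h
  simpa only [hecoe] using h

/-! ## The forward negative edge -/

/-- **NEGATIVE EDGE, FORWARD FORM (¬ crux modulo a relaxing global classical Euler flow).**  Let `(v,q)` be a classical
Euler flow on `(0,∞) × ℝ³`, nonzero at one point, with bounded energy `∫|v(s)|² ≤ M` (`s > 0`), square-summable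
enstrophy `∫∫_{(0,∞)×ℝ³} |∇v|²_F ≤ M`, pressure budget `∫∫_{(0,∞)×ℝ³} |q|^{3/2} ≤ M`, and `v`, `|∇v|²_F`, `q`
bounded by `K` on the initial unit cylinder `(0,1) × B₁`.  Then the crux `PowerGaugeEulerLiouville` (stmt-19832)
FAILS: the time-reversed flow is a budgeted classical ancient flow (`powerGaugeEulerLiouville_false_of_ancientBudgetedClassicalFlow`).
Nothing is constructed here; no such relaxing flow is known. [folklore] -/
theorem powerGaugeEulerLiouville_false_of_forwardRelaxingClassicalFlow
    {v : ℝ → EuclideanSpace ℝ (Fin 3) → EuclideanSpace ℝ (Fin 3)} {q : ℝ → EuclideanSpace ℝ (Fin 3) → ℝ}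
    {M : ℝ≥0} {K : ℝ}
    (hsol : IsClassicalEulerSolutionOn (Ioi (0 : ℝ)) 0 v q)
    (hA : ∀ s : ℝ, 0 < s → ∫⁻ x, ‖v s x‖ₑ ^ 2 ≤ (M : ℝ≥0∞))
    (hE : ∫⁻ z in Ioi (0 : ℝ) ×ˢ (univ : Set (EuclideanSpace ℝ (Fin 3))),
      ENNReal.ofReal (frobeniusNormSq (fderiv ℝ (v z.1) z.2)) ≤ (M : ℝ≥0∞))
    (hD : ∫⁻ z in Ioi (0 : ℝ) ×ˢ (univ : Set (EuclideanSpace ℝ (Fin 3))), ‖q z.1 z.2‖ₑ ^ (3 / 2 : ℝ) ≤ (M : ℝ≥0∞))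
    (hKu : ∀ s ∈ Ioo (0 : ℝ) 1, ∀ x ∈ ball (0 : EuclideanSpace ℝ (Fin 3)) 1, ‖v s x‖ ≤ K)
    (hKH : ∀ s ∈ Ioo (0 : ℝ) 1, ∀ x ∈ ball (0 : EuclideanSpace ℝ (Fin 3)) 1,
      frobeniusNormSq (fderiv ℝ (v s) x) ≤ K)
    (hKp : ∀ s ∈ Ioo (0 : ℝ) 1, ∀ x ∈ ball (0 : EuclideanSpace ℝ (Fin 3)) 1, ‖q s x‖ ≤ K)
    {s₀ : ℝ} (hs₀ : 0 < s₀) {x₀ : EuclideanSpace ℝ (Fin 3)} (hne : v s₀ x₀ ≠ 0) :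
    ¬ Summit.NavierStokesRegularity.NavierStokesRegularity.Theses.EulerZoomLiouville.PowerGaugeEulerLiouville := by
  have hfrob : ∀ A : EuclideanSpace ℝ (Fin 3) →L[ℝ] EuclideanSpace ℝ (Fin 3),
      frobeniusNormSq (-A) = frobeniusNormSq A := fun A => by
    simp [frobeniusNormSq]
  have hsol' := isClassicalEulerSolutionOn_timeReversal hsol
  have hneg : ∀ t : ℝ, t ∈ Ioo (-1 : ℝ) 0 → -t ∈ Ioo (0 : ℝ) 1 := fun t ht =>
    ⟨neg_pos.mpr ht.2, by linarith [ht.1]⟩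
  have hA' : ∀ t : ℝ, t < 0 → ∫⁻ x, ‖(fun t x => -v (-t) x) t x‖ₑ ^ 2 ≤ (M : ℝ≥0∞) := by
    intro t ht
    simpa only [enorm_neg] using hA (-t) (neg_pos.mpr ht)
  have hE' : ∫⁻ z in Iio (0 : ℝ) ×ˢ (univ : Set (EuclideanSpace ℝ (Fin 3))),
      ENNReal.ofReal (frobeniusNormSq (fderiv ℝ (fun x => -v (-z.1) x) z.2)) ≤ (M : ℝ≥0∞) := by
    have h := setLIntegral_timeReversal
      (fun w : ℝ × EuclideanSpace ℝ (Fin 3) => ENNReal.ofReal (frobeniusNormSq (fderiv ℝ (v w.1) w.2)))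
    simp only at h
    have hpt : ∀ z : ℝ × EuclideanSpace ℝ (Fin 3),
        ENNReal.ofReal (frobeniusNormSq (fderiv ℝ (fun x => -v (-z.1) x) z.2)) =
          ENNReal.ofReal (frobeniusNormSq (fderiv ℝ (v (-z.1)) z.2)) := fun z => by
      rw [fderiv_fun_neg, hfrob]
    rw [lintegral_congr hpt, h]
    exact hE
  have hD' : ∫⁻ z in Iio (0 : ℝ) ×ˢ (univ : Set (EuclideanSpace ℝ (Fin 3))),
      ‖(fun t x => q (-t) x) z.1 z.2‖ₑ ^ (3 / 2 : ℝ) ≤ (M : ℝ≥0∞) := by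
    have h := setLIntegral_timeReversal (fun w : ℝ × EuclideanSpace ℝ (Fin 3) => ‖q w.1 w.2‖ₑ ^ (3 / 2 : ℝ))
    simp only at h
    rw [h]
    exact hD
  have hKu' : ∀ t ∈ Ioo (-1 : ℝ) 0, ∀ x ∈ ball (0 : EuclideanSpace ℝ (Fin 3)) 1, ‖(fun t x => -v (-t) x) t x‖ ≤ K := by
    intro t ht x hx
    simpa only [norm_neg] using hKu (-t) (hneg t ht) x hx
  have hKH' : ∀ t ∈ Ioo (-1 : ℝ) 0, ∀ x ∈ ball (0 : EuclideanSpace ℝ (Fin 3)) 1,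
      frobeniusNormSq (fderiv ℝ ((fun t x => -v (-t) x) t) x) ≤ K := by
    intro t ht x hx
    show frobeniusNormSq (fderiv ℝ (fun y => -v (-t) y) x) ≤ K
    rw [fderiv_fun_neg, hfrob]
    exact hKH (-t) (hneg t ht) x hx
  have hKp' : ∀ t ∈ Ioo (-1 : ℝ) 0, ∀ x ∈ ball (0 : EuclideanSpace ℝ (Fin 3)) 1, ‖(fun t x => q (-t) x) t x‖ ≤ K :=
    fun t ht x hx => hKp (-t) (hneg t ht) x hx
  have ht₀ : -s₀ < 0 := neg_lt_zero.mpr hs₀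
  have hne' : (fun t x => -v (-t) x) (-s₀) x₀ ≠ 0 := by
    simpa only [neg_neg, ne_eq, neg_eq_zero] using hne
  exact powerGaugeEulerLiouville_false_of_ancientBudgetedClassicalFlow hsol' hA' hE' hD' hKu' hKH' hKp' ht₀ hne'

end Summit.NavierStokesRegularity.NavierStokesRegularity.Theorems.PowerGaugeEulerLiouville.Negative
end
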